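import Literature.MathematicalPhysics.QuantumLattice.HubbardVertexCoefficientLimit
import Literature.MathematicalPhysics.QuantumLattice.MatsubaraTruncationConvergence
import HarnessLib

/-!
# Route `KLProgramme`, crux K3, child 4 `KLRegimeTwoPointAssembly`, stub `stub_asm_matsubara` —
# part D: the SPLIT OF THE WICK MATRIX (truncated = tie-broken time-ordered kernel + remainder), entry level

Cell gate-hubbard-kl, seat t2 (HOME/t2/MATSUBARA-ALLU-SCOPE.md §2 (a)–(b)).  The Wick entry between a `ψ⁺` leg `(a,σ)` and a
`ψ⁻` leg `(b,σ')` at frequency cutoff `M` is (`vertexSub_pullback_zero_seed_apply_zero_one`)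
`−[σ=σ'] L⁻² Σ_q e^{ip_q(x_a−x_b)} g_M(ξ_q, τ_b−τ_a)`.  The Pedra–Salmhofer mode form of the UNtruncated time-ordered kernel
with the equal-time tie broken to the `0⁻` branch is
`τ_b ≤ τ_a ? Σ_m F_{aσ}(m) G_{bσ'}(m) e^{(τ_a−τ_b)ξ}/(1+e^{βξ}) : −Σ_m F_{aσ}(m) G_{bσ'}(m) e^{(τ_a−τ_b)ξ}/(1+e^{−βξ})`,
modes `m = (q, σ₀)`, `F_{aσ}(q,σ₀) = [σ₀=σ] L⁻¹ e^{iθ_q(x_a)}`, `G_{bσ'}(q,σ₀) = [σ₀=σ'] L⁻¹ e^{−iθ_q(x_b)}`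
(`θ_q(y) = Σ_j p_{q,j} y_j`).  This file proves the entry-level facts used by the determinant domination:

* `det_add_eq_sum_det_piecewise` — `det(A + B) = Σ_{S ⊆ rows} det[i ∈ S ? B_i : A_i]` (row multilinearity);
* `sum_comp_le_two_mul_sum`, `prod_comp_le_prod_sq` — bookkeeping for leg enumerations with fibres `≤ 2`;
* `sum_modes_legF_mul_legG` — `Σ_m F_{aσ}(m) G_{bσ'}(m) h(m.1) = [σ=σ'] L⁻² Σ_q e^{ip_q(x_a−x_b)} h(q)`;
  `sum_norm_sq_legF`, `sum_norm_sq_legG` — `‖F_{aσ}‖₂ = ‖G_{bσ'}‖₂ = 1`;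
* `norm_truncated_add_tieKernel_le` — the scalar heart: `|g_M(ξ,t−s) + ζ(ξ;s,t)| ≤ |g_M(ξ,t−s) − G_β(ξ,t−s)| + ½·[t=s]`
  (`ζ = −G_β` off the tie, `ζ = −G_β + ½` on it);
* **`norm_wickEntry_sub_tieKernel_le`** — `‖W_{(aσ)(bσ')} − C~_{(aσ)(bσ')}‖ ≤ [σ=σ']·δ_M(τ_b − τ_a)`,
  `δ_M(u) = L⁻² Σ_q (|g_M(ξ_q,u) − G_β(ξ_q,u)| + ½·[u=0])`.
-/

namespace Summit.HubbardSuperconductivity.HubbardSuperconductivity.Theorems.MatsubaraAllU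

set_option linter.dupNamespace false -- summit = problem name (single-conjunct summit), D-0017

open Finset Literature.MathematicalPhysics.QuantumLattice Literature.Probability.LatticeModels
open scoped ComplexConjugate

noncomputable section

/-! ### Row multilinearity and leg-enumeration bookkeeping -/

/-- **Row multilinearity of the determinant**: `det(A + B) = Σ_{S ⊆ rows} det[i ∈ S ? B_i : A_i]`. -/
theorem det_add_eq_sum_det_piecewise {N : ℕ} (A B : Matrix (Fin N) (Fin N) ℂ) :
    (A + B).det = ∑ S : Finset (Fin N), (Matrix.of fun i j => if i ∈ S then B i j else A i j).det := by
  classical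
  have h := (Matrix.detRowAlternating : (Fin N → ℂ) [⋀^Fin N]→ₗ[ℂ] ℂ).map_add_univ B A
  rw [add_comm]
  refine h.trans (Finset.sum_congr rfl fun S _ => ?_)
  change Matrix.det (S.piecewise B A) = Matrix.det _
  congr 1
  ext i j
  simp only [Matrix.of_apply, Finset.piecewise]
  split_ifs <;> rfl

/-- Sums along a map with fibres of size `≤ 2`: `Σ_j f(g j) ≤ 2 Σ_b f(b)` for `f ≥ 0`. -/
theorem sum_comp_le_two_mul_sum {N m : ℕ} (g : Fin N → Fin m)
    (hg : ∀ b, (univ.filter fun j => g j = b).card ≤ 2) (f : Fin m → ℝ) (hf : ∀ b, 0 ≤ f b) :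
    ∑ j, f (g j) ≤ 2 * ∑ b, f b := by
  classical
  rw [← Finset.sum_fiberwise_of_maps_to (t := univ) (g := g) (fun j _ => mem_univ (g j)) (fun j => f (g j)),
    Finset.mul_sum]
  refine Finset.sum_le_sum fun b _ => ?_
  have hconst : ∑ j ∈ univ.filter (fun j => g j = b), f (g j) = (univ.filter fun j => g j = b).card • f b := by
    rw [Finset.sum_congr rfl (fun j hj => by rw [(mem_filter.mp hj).2]), Finset.sum_const]
  rw [hconst, nsmul_eq_mul]
  have h2 : ((univ.filter fun j => g j = b).card : ℝ) ≤ 2 := by exact_mod_cast hg b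
  nlinarith [hf b]

/-- Products along a map with fibres of size `≤ 2`: `∏_j f(g j) ≤ ∏_b f(b)²` for `f ≥ 1`. -/
theorem prod_comp_le_prod_sq {N m : ℕ} (g : Fin N → Fin m)
    (hg : ∀ b, (univ.filter fun j => g j = b).card ≤ 2) (f : Fin m → ℝ) (hf : ∀ b, 1 ≤ f b) :
    ∏ j, f (g j) ≤ ∏ b, f b ^ 2 := by
  classical
  rw [← Finset.prod_fiberwise_of_maps_to (t := univ) (g := g) (fun j _ => mem_univ (g j)) (fun j => f (g j))]
  refine Finset.prod_le_prod (fun b _ => Finset.prod_nonneg fun j _ => zero_le_one.trans (hf _)) fun b _ => ?_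
  have hconst : ∏ j ∈ univ.filter (fun j => g j = b), f (g j) = f b ^ (univ.filter fun j => g j = b).card := by
    rw [Finset.prod_congr rfl (fun j hj => by rw [(mem_filter.mp hj).2]), Finset.prod_const]
  rw [hconst]
  exact pow_le_pow_right₀ (hf b) (hg b)

/-! ### The mode data of the legs -/

variable {L : ℕ} [NeZero L]

/-- **The leg modes reproduce the Wick phase**: for `h : TorusSite 2 L → ℂ`,
`Σ_{(q,σ₀)} F_{aσ}(q,σ₀) G_{bσ'}(q,σ₀) h(q) = [σ=σ'] L⁻² Σ_q e^{ip_q(x_a−x_b)} h(q)`. -/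
theorem sum_modes_legF_mul_legG (xa xb : TorusSite 2 L) (σ σ' : Fin 2) (h : TorusSite 2 L → ℂ) :
    ∑ m : TorusSite 2 L × Fin 2,
      (if m.2 = σ then ((1 / (L : ℝ) : ℝ) : ℂ) *
          Complex.exp (((∑ j, latticeMomentum L m.1 j * ((xa j).val : ℝ) : ℝ) : ℂ) * Complex.I) else 0) *
        (if m.2 = σ' then ((1 / (L : ℝ) : ℝ) : ℂ) *
          Complex.exp (-(((∑ j, latticeMomentum L m.1 j * ((xb j).val : ℝ) : ℝ) : ℂ) * Complex.I)) else 0) *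
        h m.1 =
      if σ = σ' then ((1 / (L : ℝ) ^ 2 : ℝ) : ℂ) * ∑ q : TorusSite 2 L,
        Complex.exp (((∑ j, latticeMomentum L q j * (((xa j).val : ℝ) - ((xb j).val : ℝ)) : ℝ) : ℂ) * Complex.I) *
          h q else 0 := by
  rw [Fintype.sum_prod_type]
  dsimp only
  have hphase : ∀ q : TorusSite 2 L,
      Complex.exp (((∑ j, latticeMomentum L q j * ((xa j).val : ℝ) : ℝ) : ℂ) * Complex.I) *
        Complex.exp (-(((∑ j, latticeMomentum L q j * ((xb j).val : ℝ) : ℝ) : ℂ) * Complex.I)) =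
      Complex.exp (((∑ j, latticeMomentum L q j * (((xa j).val : ℝ) - ((xb j).val : ℝ)) : ℝ) : ℂ) * Complex.I) := by
    intro q
    rw [← Complex.exp_add]
    congr 1
    simp only [mul_sub, Finset.sum_sub_distrib]
    push_cast
    ring
  have hL2 : ((1 / (L : ℝ) : ℝ) : ℂ) * ((1 / (L : ℝ) : ℝ) : ℂ) = ((1 / (L : ℝ) ^ 2 : ℝ) : ℂ) := by
    push_cast; ring
  by_cases hσ : σ = σ'
  · subst hσ
    rw [if_pos rfl, Finset.mul_sum]
    refine Finset.sum_congr rfl fun q _ => ?_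
    rw [Finset.sum_eq_single σ]
    · simp only [if_true]
      rw [← hphase q, ← hL2]
      ring
    · intro σ₀ _ hne
      rw [if_neg hne, zero_mul, zero_mul]
    · intro hh
      exact absurd (mem_univ σ) hh
  · rw [if_neg hσ]
    refine Finset.sum_eq_zero fun q _ => Finset.sum_eq_zero fun σ₀ _ => ?_
    by_cases h1 : σ₀ = σ
    · subst h1
      rw [if_neg hσ, mul_zero, zero_mul]
    · rw [if_neg h1, zero_mul, zero_mul]

/-- `‖F_{aσ}‖₂² = 1`. -/
theorem sum_norm_sq_legF (xa : TorusSite 2 L) (σ : Fin 2) :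
    ∑ m : TorusSite 2 L × Fin 2,
      ‖(if m.2 = σ then ((1 / (L : ℝ) : ℝ) : ℂ) *
          Complex.exp (((∑ j, latticeMomentum L m.1 j * ((xa j).val : ℝ) : ℝ) : ℂ) * Complex.I) else 0)‖ ^ 2 = 1 := by
  have hL : (L : ℝ) ≠ 0 := by exact_mod_cast NeZero.ne L
  rw [Fintype.sum_prod_type]
  have hq : ∀ q : TorusSite 2 L, ∑ σ₀ : Fin 2,
      ‖(if σ₀ = σ then ((1 / (L : ℝ) : ℝ) : ℂ) *
          Complex.exp (((∑ j, latticeMomentum L q j * ((xa j).val : ℝ) : ℝ) : ℂ) * Complex.I) else 0)‖ ^ 2 =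
      (1 / (L : ℝ)) ^ 2 := by
    intro q
    rw [Finset.sum_eq_single σ]
    · rw [if_pos rfl, norm_mul, Complex.norm_exp_ofReal_mul_I, mul_one, Complex.norm_real,
        Real.norm_of_nonneg (by positivity)]
    · intro σ₀ _ h; rw [if_neg h, norm_zero, zero_pow two_ne_zero]
    · intro h; exact absurd (mem_univ σ) h
  simp_rw [hq]
  rw [Finset.sum_const, card_univ, nsmul_eq_mul, Fintype.card_pi, prod_const, ZMod.card, card_univ, Fintype.card_fin,
    Nat.cast_pow]
  field_simp

/-- `‖G_{bσ'}‖₂² = 1`. -/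
theorem sum_norm_sq_legG (xb : TorusSite 2 L) (σ' : Fin 2) :
    ∑ m : TorusSite 2 L × Fin 2,
      ‖(if m.2 = σ' then ((1 / (L : ℝ) : ℝ) : ℂ) *
          Complex.exp (-(((∑ j, latticeMomentum L m.1 j * ((xb j).val : ℝ) : ℝ) : ℂ) * Complex.I)) else 0)‖ ^ 2 =
      1 := by
  have hL : (L : ℝ) ≠ 0 := by exact_mod_cast NeZero.ne L
  rw [Fintype.sum_prod_type]
  have hq : ∀ q : TorusSite 2 L, ∑ σ₀ : Fin 2,
      ‖(if σ₀ = σ' then ((1 / (L : ℝ) : ℝ) : ℂ) *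
          Complex.exp (-(((∑ j, latticeMomentum L q j * ((xb j).val : ℝ) : ℝ) : ℂ) * Complex.I)) else 0)‖ ^ 2 =
      (1 / (L : ℝ)) ^ 2 := by
    intro q
    rw [Finset.sum_eq_single σ']
    · rw [if_pos rfl, norm_mul, ← neg_mul, ← Complex.ofReal_neg, Complex.norm_exp_ofReal_mul_I, mul_one,
        Complex.norm_real, Real.norm_of_nonneg (by positivity)]
    · intro σ₀ _ h; rw [if_neg h, norm_zero, zero_pow two_ne_zero]
    · intro h; exact absurd (mem_univ σ') h
  simp_rw [hq]
  rw [Finset.sum_const, card_univ, nsmul_eq_mul, Fintype.card_pi, prod_const, ZMod.card, card_univ, Fintype.card_fin,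
    Nat.cast_pow]
  field_simp

/-! ### The scalar heart: truncated propagator versus the tie-broken time-ordered kernel -/

omit [NeZero L] in
/-- **The tie-broken kernel is the time-ordered propagator up to `½` on the tie**: with `u = t − s` and
`ζ = (t ≤ s ? e^{(s−t)ξ}/(1+e^{βξ}) : −e^{(s−t)ξ}/(1+e^{−βξ}))`, one has `ζ = −G_β(ξ,u)` for `u ≠ 0` and
`ζ = −G_β(ξ,0) + ½` for `u = 0` (`G_β = timeOrderedPropagator`, midpoint at `0`); hence for any complex `g`,
`|g + ζ| ≤ |g − G_β(ξ,u)| + ½·[u = 0]`. -/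
theorem norm_truncated_add_tieKernel_le (β ξ s t : ℝ) (g : ℂ) :
    ‖g + ((if t ≤ s then Real.exp ((s - t) * ξ) * (1 + Real.exp (β * ξ))⁻¹
        else -(Real.exp ((s - t) * ξ) * (1 + Real.exp (-(β * ξ)))⁻¹) : ℝ) : ℂ)‖ ≤
      ‖g - ((timeOrderedPropagator β ξ (t - s) : ℝ) : ℂ)‖ + if t - s = 0 then (1 / 2 : ℝ) else 0 := by
  set ζ : ℝ := if t ≤ s then Real.exp ((s - t) * ξ) * (1 + Real.exp (β * ξ))⁻¹
        else -(Real.exp ((s - t) * ξ) * (1 + Real.exp (-(β * ξ)))⁻¹) with hζ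
  have hsplit : g + (ζ : ℂ) = (g - ((timeOrderedPropagator β ξ (t - s) : ℝ) : ℂ)) +
      (((ζ + timeOrderedPropagator β ξ (t - s) : ℝ)) : ℂ) := by push_cast; ring
  have hsum : ζ + timeOrderedPropagator β ξ (t - s) = if t - s = 0 then (1 / 2 : ℝ) else 0 := by
    rcases lt_trichotomy (t - s) 0 with h | h | h
    · have hts : t ≤ s := by linarith
      rw [if_neg h.ne, hζ, if_pos hts, timeOrderedPropagator, if_neg (not_lt.2 h.le), if_pos h,
        show -(ξ * (t - s)) = (s - t) * ξ by ring]
      ring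
    · have hts : t ≤ s := by linarith
      have hst : s - t = 0 := by linarith
      rw [if_pos h, hζ, if_pos hts, h, timeOrderedPropagator, if_neg (lt_irrefl 0), if_neg (lt_irrefl 0), hst,
        zero_mul, Real.exp_zero, one_mul]
      ring
    · have hts : ¬ t ≤ s := fun h' => by linarith
      rw [if_neg h.ne', hζ, if_neg hts, timeOrderedPropagator, if_pos h,
        show -(ξ * (t - s)) = (s - t) * ξ by ring]
      ring
  rw [hsplit]
  refine (norm_add_le _ _).trans (add_le_add le_rfl ?_)
  rw [Complex.norm_real, Real.norm_eq_abs, hsum]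
  split_ifs <;> norm_num

/-- Abstract form of the remainder-entry estimate: unit phases, a common real prefactor. -/
theorem norm_neg_mul_sum_sub_mul_sum_le {ι : Type*} [Fintype ι] (c : ℝ) (hc : 0 ≤ c) (E g ζ : ι → ℂ)
    (hE : ∀ q, ‖E q‖ = 1) (B : ι → ℝ) (hB : ∀ q, ‖g q + ζ q‖ ≤ B q) :
    ‖-((c : ℂ) * ∑ q, E q * g q) - (c : ℂ) * ∑ q, E q * ζ q‖ ≤ c * ∑ q, B q := by
  have hre : -((c : ℂ) * ∑ q, E q * g q) - (c : ℂ) * ∑ q, E q * ζ q = -((c : ℂ) * ∑ q, E q * (g q + ζ q)) := by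
    rw [Finset.mul_sum, Finset.mul_sum, Finset.mul_sum, neg_sub_left, ← Finset.sum_add_distrib]
    congr 1
    exact Finset.sum_congr rfl fun q _ => by ring
  rw [hre, norm_neg, norm_mul, Complex.norm_real, Real.norm_of_nonneg hc]
  refine mul_le_mul_of_nonneg_left ((norm_sum_le _ _).trans (Finset.sum_le_sum fun q _ => ?_)) hc
  rw [norm_mul, hE, one_mul]
  exact hB q

/-- **The remainder entry is bounded by the scalar majorant.**  For legs `(a,σ)` (`ψ⁺`, time `τ_a`) and `(b,σ')` (`ψ⁻`,
time `τ_b`) the difference of the finite-`M` Wick entry and the tie-broken time-ordered kernel in mode form satisfies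
`‖W − C~‖ ≤ [σ=σ'] · L⁻² Σ_q (|g_M(ξ_q,τ_b−τ_a) − G_β(ξ_q,τ_b−τ_a)| + ½·[τ_b = τ_a])`. -/
theorem norm_wickEntry_sub_tieKernel_le {M : ℕ} {β : ℝ} (hβ : β ≠ 0) (μ : ℝ) {n : ℕ}
    (x : Fin n → TorusSite 2 L) (τ : Fin n → ℝ) (a b : Fin n) (σ σ' : Fin 2) :
    ‖-((vertexSubMatrix L M β x τ).transpose * hubbardCovariance L M β μ 0 * vertexSubMatrix L M β x τ)
          ((a, σ), 0) ((b, σ'), 1) -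
        (if τ b ≤ τ a then
          ∑ m : TorusSite 2 L × Fin 2,
            (if m.2 = σ then ((1 / (L : ℝ) : ℝ) : ℂ) *
                Complex.exp (((∑ j, latticeMomentum L m.1 j * ((x a j).val : ℝ) : ℝ) : ℂ) * Complex.I) else 0) *
              (if m.2 = σ' then ((1 / (L : ℝ) : ℝ) : ℂ) *
                Complex.exp (-(((∑ j, latticeMomentum L m.1 j * ((x b j).val : ℝ) : ℝ) : ℂ) * Complex.I)) else 0) *
              ((Real.exp ((τ a - τ b) * nambuXi L μ m.1) * (1 + Real.exp (β * nambuXi L μ m.1))⁻¹ : ℝ) : ℂ)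
        else -∑ m : TorusSite 2 L × Fin 2,
            (if m.2 = σ then ((1 / (L : ℝ) : ℝ) : ℂ) *
                Complex.exp (((∑ j, latticeMomentum L m.1 j * ((x a j).val : ℝ) : ℝ) : ℂ) * Complex.I) else 0) *
              (if m.2 = σ' then ((1 / (L : ℝ) : ℝ) : ℂ) *
                Complex.exp (-(((∑ j, latticeMomentum L m.1 j * ((x b j).val : ℝ) : ℝ) : ℂ) * Complex.I)) else 0) *
              ((Real.exp ((τ a - τ b) * nambuXi L μ m.1) * (1 + Real.exp (-(β * nambuXi L μ m.1)))⁻¹ : ℝ) : ℂ))‖ ≤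
      if σ = σ' then (1 / (L : ℝ) ^ 2) * ∑ q : TorusSite 2 L,
        (‖(1 / (β : ℂ)) * ∑ i : MatsubaraIdx M, Complex.exp (-(Complex.I * matsubaraFreq β M i * ((τ b - τ a : ℝ) : ℂ))) *
              (1 / (-(Complex.I * matsubaraFreq β M i) + nambuXi L μ q)) -
            ((timeOrderedPropagator β (nambuXi L μ q) (τ b - τ a) : ℝ) : ℂ)‖ +
          if τ b - τ a = 0 then (1 / 2 : ℝ) else 0)
      else 0 := by
  -- the tie-broken kernel with the sign pulled inside, per momentum
  set ζ : TorusSite 2 L → ℝ := fun q => if τ b ≤ τ a then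
      Real.exp ((τ a - τ b) * nambuXi L μ q) * (1 + Real.exp (β * nambuXi L μ q))⁻¹
    else -(Real.exp ((τ a - τ b) * nambuXi L μ q) * (1 + Real.exp (-(β * nambuXi L μ q)))⁻¹) with hζ
  have hC : (if τ b ≤ τ a then
          ∑ m : TorusSite 2 L × Fin 2,
            (if m.2 = σ then ((1 / (L : ℝ) : ℝ) : ℂ) *
                Complex.exp (((∑ j, latticeMomentum L m.1 j * ((x a j).val : ℝ) : ℝ) : ℂ) * Complex.I) else 0) *
              (if m.2 = σ' then ((1 / (L : ℝ) : ℝ) : ℂ) *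
                Complex.exp (-(((∑ j, latticeMomentum L m.1 j * ((x b j).val : ℝ) : ℝ) : ℂ) * Complex.I)) else 0) *
              ((Real.exp ((τ a - τ b) * nambuXi L μ m.1) * (1 + Real.exp (β * nambuXi L μ m.1))⁻¹ : ℝ) : ℂ)
        else -∑ m : TorusSite 2 L × Fin 2,
            (if m.2 = σ then ((1 / (L : ℝ) : ℝ) : ℂ) *
                Complex.exp (((∑ j, latticeMomentum L m.1 j * ((x a j).val : ℝ) : ℝ) : ℂ) * Complex.I) else 0) *
              (if m.2 = σ' then ((1 / (L : ℝ) : ℝ) : ℂ) *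
                Complex.exp (-(((∑ j, latticeMomentum L m.1 j * ((x b j).val : ℝ) : ℝ) : ℂ) * Complex.I)) else 0) *
              ((Real.exp ((τ a - τ b) * nambuXi L μ m.1) * (1 + Real.exp (-(β * nambuXi L μ m.1)))⁻¹ : ℝ) : ℂ)) =
      if σ = σ' then ((1 / (L : ℝ) ^ 2 : ℝ) : ℂ) * ∑ q : TorusSite 2 L,
        Complex.exp (((∑ j, latticeMomentum L q j * (((x a j).val : ℝ) - ((x b j).val : ℝ)) : ℝ) : ℂ) * Complex.I) *
          ((ζ q : ℝ) : ℂ) else 0 := by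
    by_cases hts : τ b ≤ τ a
    · rw [if_pos hts]
      have h2 := sum_modes_legF_mul_legG (x a) (x b) σ σ'
        (fun q => ((Real.exp ((τ a - τ b) * nambuXi L μ q) * (1 + Real.exp (β * nambuXi L μ q))⁻¹ : ℝ) : ℂ))
      beta_reduce at h2
      rw [h2]
      simp only [hζ, if_pos hts]
    · rw [if_neg hts]
      have h2 := sum_modes_legF_mul_legG (x a) (x b) σ σ'
        (fun q => ((Real.exp ((τ a - τ b) * nambuXi L μ q) * (1 + Real.exp (-(β * nambuXi L μ q)))⁻¹ : ℝ) : ℂ))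
      beta_reduce at h2
      rw [h2]
      split_ifs with hσ
      · rw [← mul_neg, ← Finset.sum_neg_distrib]
        congr 1
        refine Finset.sum_congr rfl fun q _ => ?_
        simp only [hζ, if_neg hts]
        push_cast
        ring
      · rw [neg_zero]
  rw [hC, vertexSub_pullback_zero_seed_apply_zero_one hβ]
  by_cases hσ : σ = σ'
  · rw [if_pos hσ, if_pos hσ, if_pos hσ]
    exact norm_neg_mul_sum_sub_mul_sum_le (1 / (L : ℝ) ^ 2) (by positivity) _ _ _
      (fun q => Complex.norm_exp_ofReal_mul_I _) _
      (fun q => norm_truncated_add_tieKernel_le β (nambuXi L μ q) (τ a) (τ b) _)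
  · rw [if_neg hσ, if_neg hσ, if_neg hσ]
    simp

end

end Summit.HubbardSuperconductivity.HubbardSuperconductivity.Theorems.MatsubaraAllU
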